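import Literature.Geometry.Lorentzian.KerrStarSlices
import HarnessLib

/-!
# The azimuthal rule `∂_{φ*} ↦ im` for the pairing with oblate spheroidal harmonics

Dafermos–Rodnianski–Shlapentokh-Rothman, arXiv:1402.7034, §5.2.2: in the expansion in oblate
spheroidal harmonics `S_{mℓ}(aω, cos θ) e^{imφ}`, the azimuthal derivative becomes multiplication
by `im`. For the tree's Hilbert basis `Ψ_q = oblateSphereBasis (2π) ν q = S_q ⊗ e_{m}`,
`m = q.1` (`OblateSpheroidalSphereBasis`), this file proves

* `inner_tensorLp_fourierLp_polarLp`: the pairing of any `f ⊗ e_m` (`f ∈ L²[-1,1]`) with a polar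
  pull-back `𝓛g` is `(1/T) ∫ conj f(x) · modeCoeff T m (g(arccos x)) dx`;
* `inner_tensorLp_fourierLp_polarLp_deriv`: for `g` `T`-periodic in `φ` with continuous
  `∂_φ g`, `⟪f ⊗ e_m, 𝓛(∂_φ g)⟫ = (2πim/T) ⟪f ⊗ e_m, 𝓛g⟫` (periodic integration by parts,
  `modeCoeff_hasDerivAt_eq`);
* **`Kerr.inner_oblateSphereBasis_angSlice_dir3`**: for `G ∈ C¹` on the coordinate space,
  `2π`-periodic in `φ*`, `⟪Ψ_q, angSlice (∂₃G) t r⟫ = (i q.1) ⟪Ψ_q, angSlice G t r⟫`.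

## References

* M. Dafermos, I. Rodnianski, Y. Shlapentokh-Rothman, arXiv:1402.7034, §5.2.2.
  [DafermosRodnianskiShlapentokhrothman2014]
-/

noncomputable section

open Real Set Filter MeasureTheory Function Complex
open scoped Topology InnerProductSpace ComplexConjugate

namespace Literature.Geometry.Lorentzian

namespace Kerr

open Literature.Analysis.SpecialFunctions Literature.Analysis.FunctionSpaces
  Literature.Analysis.Fourier

/-! ### The pairing of `f ⊗ e_m` with a polar pull-back -/

section Bridge

variable {T : ℝ} [hT : Fact (0 < T)]

/-- **`⟪f ⊗ e_m, 𝓛g⟫ = (1/T) ∫ conj f(x) · modeCoeff T m (g(arccos x)) dx`** for every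
`f ∈ L²[-1, 1]`. [folklore] -/
theorem inner_tensorLp_fourierLp_polarLp (f : Lp ℂ 2 legendreMeasure) (m : ℤ) (g : ℝ → ℝ → ℂ)
    (hg : Continuous (uncurry g)) :
    ⟪tensorLp f (fourierLp (T := T) 2 m), polarLp T g hg⟫_ℂ =
      ((1 / T : ℝ) : ℂ) * ∫ x, conj (f x) * modeCoeff T m (g (arccos x)) ∂legendreMeasure := by
  set e : Lp ℂ 2 (AddCircle.haarAddCircle : Measure (AddCircle T)) := fourierLp (T := T) 2 m
    with he
  obtain ⟨C, hC⟩ := exists_bound_polarFn T hg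
  have hint : Integrable (fun z : ℝ × AddCircle T ↦ conj (f z.1) * (conj (e z.2) * polarFn T g z))
      (sphereMeasure T) := by
    have hF : Integrable (fun z : ℝ × AddCircle T ↦ f z.1 * e z.2) (sphereMeasure T) :=
      (memLp_two_tensor f e).integrable one_le_two
    refine (hF.norm.const_mul C).mono' ?_ ?_
    · exact ((RCLike.continuous_conj.comp_aestronglyMeasurable (Lp.memLp f).1.comp_fst).mul
        ((RCLike.continuous_conj.comp_aestronglyMeasurable (Lp.memLp e).1.comp_snd).mul
          (measurable_polarFn T hg).aestronglyMeasurable))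
    · refine ae_of_all _ fun z ↦ ?_
      rw [norm_mul, norm_mul, norm_mul, RCLike.norm_conj, RCLike.norm_conj, ← mul_assoc]
      have h0 : 0 ≤ ‖f z.1‖ * ‖e z.2‖ := by positivity
      calc ‖f z.1‖ * ‖e z.2‖ * ‖polarFn T g z‖ ≤ ‖f z.1‖ * ‖e z.2‖ * C :=
            mul_le_mul_of_nonneg_left (hC z) h0
        _ = C * (‖f z.1‖ * ‖e z.2‖) := by ring
  rw [inner_tensorLp_left_of_ae_eq f e _ (coeFn_polarLp T g hg) hint]
  have hinner : ∀ x, (∫ y, conj (e y) * polarFn T g (x, y) ∂AddCircle.haarAddCircle) =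
      ((1 / T : ℝ) : ℂ) * modeCoeff T m (g (arccos x)) := fun x ↦ by
    rw [he, integral_conj_fourierLp_mul, intervalIntegral_fourier_mul_polarFn, Complex.real_smul]
  simp_rw [hinner]
  have hfun : (fun x ↦ conj (f x) * (((1 / T : ℝ) : ℂ) * modeCoeff T m (g (arccos x)))) =
      fun x ↦ ((1 / T : ℝ) : ℂ) * (conj (f x) * modeCoeff T m (g (arccos x))) := by
    funext x
    ring
  rw [hfun, MeasureTheory.integral_const_mul]

/-- **Periodic integration by parts in the pairing**: if `g(θ, ·)` is `T`-periodic with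
continuous `φ`-derivative `gφ(θ, ·)`, then `⟪f ⊗ e_m, 𝓛gφ⟫ = (2πim/T) ⟪f ⊗ e_m, 𝓛g⟫`.
[cite: DafermosRodnianskiShlapentokhrothman2014, §5.2.2] -/
theorem inner_tensorLp_fourierLp_polarLp_deriv (f : Lp ℂ 2 legendreMeasure) (m : ℤ)
    {g gφ : ℝ → ℝ → ℂ} (hg : Continuous (uncurry g)) (hgφ : Continuous (uncurry gφ))
    (hd : ∀ θ φ, HasDerivAt (g θ) (gφ θ φ) φ) (hper : ∀ θ, g θ T = g θ 0) :
    ⟪tensorLp f (fourierLp (T := T) 2 m), polarLp T gφ hgφ⟫_ℂ =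
      (2 * π * I * m / T) * ⟪tensorLp f (fourierLp (T := T) 2 m), polarLp T g hg⟫_ℂ := by
  rw [inner_tensorLp_fourierLp_polarLp, inner_tensorLp_fourierLp_polarLp, ← mul_assoc,
    mul_comm (2 * π * I * m / T) _, mul_assoc,
    ← MeasureTheory.integral_const_mul (2 * π * I * m / T)]
  congr 1
  refine integral_congr_ae (ae_of_all _ fun x ↦ ?_)
  have hmode : modeCoeff T m (gφ (arccos x)) =
      (2 * π * I * m / T) * modeCoeff T m (g (arccos x)) :=
    modeCoeff_hasDerivAt_eq m (fun φ _ ↦ hd (arccos x) φ)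
      ((hgφ.comp (continuous_const.prodMk continuous_id)).intervalIntegrable _ _) (hper _)
  dsimp only
  rw [hmode]
  ring

end Bridge

/-! ### The rule for angular slices on Kerr (`T = 2π`) -/

section Kerr

variable [h2π : Fact (0 < 2 * π)]

/-- **`∂_{φ*} ↦ im`**: for `G ∈ C¹` on the coordinate space, `2π`-periodic in `φ*`, and every
index `q` (`m = q.1`), `⟪Ψ_q, angSlice (∂₃G) t r⟫ = (im) ⟪Ψ_q, angSlice G t r⟫`.
[cite: DafermosRodnianskiShlapentokhrothman2014, §5.2.2] -/
theorem inner_oblateSphereBasis_angSlice_dir3 {G : E4 → ℝ} (hG : ContDiff ℝ 1 G)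
    (hper : ∀ q : E4, G (q + (2 * π) • E4.basisVector 3) = G q) (ν : ℝ) (q : OblateSphereIndex ν)
    (t r : ℝ) :
    ⟪oblateSphereBasis (2 * π) ν q, angSlice (dir 3 G) (continuous_dir hG one_ne_zero 3) t r⟫_ℂ =
      (I * q.1) * ⟪oblateSphereBasis (2 * π) ν q, angSlice G hG.continuous t r⟫_ℂ := by
  rw [oblateSphereBasis_apply, angSlice_def, angSlice_def,
    inner_tensorLp_fourierLp_polarLp_deriv _ q.1 (continuous_coordSlice hG.continuous t r)
      (continuous_coordSlice (continuous_dir hG one_ne_zero 3) t r)]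
  · congr 1
    have hπ : (π : ℂ) ≠ 0 := by exact_mod_cast pi_ne_zero
    field_simp
    push_cast
    ring
  · intro θ φ
    simp only [coordSlice_apply, dir_apply]
    exact (hasDerivAt_comp_starq_phi t r θ φ (hG.differentiable one_ne_zero _)).ofReal_comp
  · intro θ
    simp only [coordSlice_apply]
    rw [show (2 * π : ℝ) = 0 + 2 * π by ring, starq_add_phi, hper]

end Kerr

end Kerr

end Literature.Geometry.Lorentzian
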